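import Literature.NumberTheory.Automorphic.BLZPeriodCocycleCollar
import Literature.NumberTheory.Automorphic.BLZPeriodCocycleAnalyticityProofs

/-!
# BLZ Proposition 5.1 — injectivity of `r : E_s^Γ → H¹(Γ; V_s^ω)` (discharge)

Bruggeman, Lewis and Zagier, *Period functions for Maass wave forms and cohomology*,
Mem. AMS 237 no. 1118 (2015) [BruggemanLewisZagier2015], Proposition 5.1 (p. 30; proof p. 31;
page numbers = PDF pages of the held authors' version `paper:doi-10-1090-memo-1118`):
"If the discrete subgroup `Γ ⊂ G` is infinite, then `r`, `p` and `q` are injective."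
This file proves the named fact `BruggemanLewisZagier2015_prop_5_1` of `BLZPeriodCocycle.lean`
(the statement for `r`) as `BruggemanLewisZagier2015_prop_5_1_holds`, concluding the chain
`BLZPeriodCocycleProofs` (§1–§8) → `BLZPeriodCocycleHolomorphy` (§9–§16) →
`BLZPeriodCocycleTransform` (§17–§22) → `BLZPeriodCocycleCollar` (§23–§28).

## The argument (§29–§30)

The printed proof (p. 31): `r` is the composite of the injection `E_s^Γ → (V_s^{-ω})^Γ`
(Theorem 2.2) with the connecting map of `0 → V_s^ω → H_s → V_s^{-ω} → 0` ((2.12)), whose kernel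
`H_s^Γ` (germs of holomorphic functions on a deleted neighbourhood of `P¹(ℝ)`, invariant under
an infinite discrete `Γ`) vanishes by an argument-principle computation on a collar of `S¹`
using `s ∉ ℤ`. It is realized here in the canonical hybrid model of the companion paper
(Bruggeman–Lewis–Zagier, *Function theory related to the group PSL₂(ℝ)*, §4.2): with the base
point `z₀`, the collar extension `Φ(η) = φ(η) R_η(z₀)^{-s}` of the analytic vector `φ` and the
canonical integral `h(η) = ∫_{z₀}^{η} [u, (R_η/R_η(z₀))^s]` (holomorphic on `ℍ`), the coboundary
hypothesis `r_γ = φ|γ - φ` makes `D = Φ - h` satisfy `D(g⁻¹η) = μ(η)^s D(η)`; the argument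
principle on a collar (`collar_vanishing`) gives `Φ = h` on the upper collar, and the same for
the conjugate system `(ū, s̄, φ̃)`; by the identity theorem along `ℝ`,
`Φ̃(η) = -conj Φ(η̄) - conj u(z₀)`, so the function equal to `h` on `ℍ`, to `Φ` on `ℝ` and to
`-u(z₀) - conj h̃(η̄)` on `ℍ⁻` is entire and bounded, hence constant (Liouville), and its values
at `z₀`, `z̄₀` are `0`, `-u(z₀)`: so `u(z₀) = 0`. The hypothesis is then transported from `z₀` to
every `z ∈ ℍ` (the cocycles differ by the coboundary of `t ↦ ∫_z^{z₀} [u, R_t^s] ∈ V_s^ω`,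
`isAnalyticVector_greenPeriod` of `BLZPeriodCocycleAnalyticityProofs`).

## References

* [BruggemanLewisZagier2015] R. Bruggeman, J. Lewis, D. Zagier, *Period functions for Maass wave
  forms and cohomology*, Mem. Amer. Math. Soc. 237 (2015), no. 1118, doi:10.1090/memo/1118:
  (1.6) p. 10; (2.1)–(2.2) pp. 11–12; (2.12) p. 14; (2.25) p. 16; (5.4)–(5.5a) p. 29;
  Proposition 5.1 pp. 30–31.
* R. Bruggeman, J. Lewis, D. Zagier, *Function theory related to the group PSL₂(ℝ)*, in
  *From Fourier analysis and number theory to Radon transforms and geometry*, Dev. Math. 28,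
  Springer (2013), 107–201, §4.2, Theorem 4.2.
-/

noncomputable section

namespace Literature.NumberTheory.Automorphic

open _root_.UpperHalfPlane _root_.Complex _root_.Filter _root_.Set _root_.MeasureTheory
open scoped MatrixGroups Topology ComplexConjugate
open Laplacian

/-! ## 29. Analytic vectors for the conjugate system

`conj ∘ φ ∈ V_{s̄}^ω` for `φ ∈ V_s^ω`; `κ_w(t) = R_t(z₀)^w ∈ V_w^ω` (at `∞`:
`|t|^{-2w} R_{-1/t}(z₀)^w = (y₀/|t z₀ + 1|²)^w`); `V^ω` is stable under sums and scalars. -/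

section ConjAnalyticVectors

/-- `conj (x^m) = x^{conj m}` for a nonnegative real base. [folklore] -/
theorem conj_ofReal_cpow_of_nonneg {x : ℝ} (hx : 0 ≤ x) (m : ℂ) :
    conj (((x : ℝ) : ℂ) ^ m) = ((x : ℝ) : ℂ) ^ conj m := by
  have harg : ((x : ℝ) : ℂ).arg ≠ Real.pi := by
    rw [Complex.arg_ofReal_of_nonneg hx]; exact Real.pi_ne_zero.symm
  have h := Complex.conj_cpow ((x : ℝ) : ℂ) (conj m) harg
  rw [Complex.conj_conj, Complex.conj_ofReal] at h
  exact h.symm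

/-- **`conj ∘ φ ∈ V_{s̄}^ω` for `φ ∈ V_s^ω`.** [cite: BruggemanLewisZagier2015, (2.2) p. 12] -/
theorem IsAnalyticVector.conj_comp {s : ℂ} {φ : ℝ → ℂ} (h : IsAnalyticVector s φ) :
    IsAnalyticVector (conj s) (fun x => conj (φ x)) := by
  obtain ⟨hφ, ψ, hψ, hψeq⟩ := h
  refine ⟨fun t _ => ?_, fun t => conj (ψ t), ?_, fun t ht => ?_⟩
  · exact ((Complex.conjCLE : ℂ ≃L[ℝ] ℂ).analyticAt _).comp (hφ t (mem_univ t))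
  · exact ((Complex.conjCLE : ℂ ≃L[ℝ] ℂ).analyticAt _).comp hψ
  · beta_reduce
    rw [hψeq t ht, map_mul, conj_ofReal_cpow_of_nonneg (abs_nonneg t), map_neg, map_mul, map_ofNat]

/-- `V_s^ω` is stable under addition. [cite: BruggemanLewisZagier2015, (2.2) p. 12] -/
theorem IsAnalyticVector.add {s : ℂ} {φ φ' : ℝ → ℂ} (h : IsAnalyticVector s φ)
    (h' : IsAnalyticVector s φ') : IsAnalyticVector s (fun x => φ x + φ' x) := by
  obtain ⟨hφ, ψ, hψ, hψeq⟩ := h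
  obtain ⟨hφ', ψ', hψ', hψeq'⟩ := h'
  refine ⟨fun t _ => (hφ t (mem_univ t)).add (hφ' t (mem_univ t)), fun t => ψ t + ψ' t,
    hψ.add hψ', fun t ht => ?_⟩
  beta_reduce
  rw [hψeq t ht, hψeq' t ht]; ring

/-- `V_s^ω` is stable under scalar multiplication. [cite: BruggemanLewisZagier2015, (2.2) p. 12] -/
theorem IsAnalyticVector.const_mul {s : ℂ} {φ : ℝ → ℂ} (h : IsAnalyticVector s φ) (c : ℂ) :
    IsAnalyticVector s (fun x => c * φ x) := by
  obtain ⟨hφ, ψ, hψ, hψeq⟩ := h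
  refine ⟨fun t _ => analyticAt_const.mul (hφ t (mem_univ t)), fun t => c * ψ t,
    analyticAt_const.mul hψ, fun t ht => ?_⟩
  beta_reduce
  rw [hψeq t ht]; ring

/-- `V_s^ω` is stable under negation. [cite: BruggemanLewisZagier2015, (2.2) p. 12] -/
theorem IsAnalyticVector.neg {s : ℂ} {φ : ℝ → ℂ} (h : IsAnalyticVector s φ) :
    IsAnalyticVector s (fun x => -φ x) := by
  have := h.const_mul (-1)
  simpa using this

/-- `R_t(z) = y/((x - t)² + y²)`. [cite: BruggemanLewisZagier2015, (1.6) p. 10] -/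
theorem hypPoissonKernel_eq_div (t : ℝ) (z : ℂ) :
    hypPoissonKernel t z = z.im / ((z.re - t) ^ 2 + z.im ^ 2) := by
  rw [hypPoissonKernel, Complex.sq_norm, Complex.normSq_apply]
  congr 1
  simp only [Complex.sub_re, Complex.ofReal_re, Complex.sub_im, Complex.ofReal_im, sub_zero]
  ring

/-- `t ↦ R_t(z)` is real-analytic for `z ∈ ℍ`. [cite: BruggemanLewisZagier2015, (1.6) p. 10] -/
theorem analyticAt_hypPoissonKernel (z : ℍ) (t : ℝ) :
    AnalyticAt ℝ (fun x : ℝ => hypPoissonKernel x z) t := by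
  have e : (fun x : ℝ => hypPoissonKernel x z) = fun x => z.im / (((z : ℂ).re - x) ^ 2 + z.im ^ 2) := by
    funext x; rw [hypPoissonKernel_eq_div]; rfl
  rw [e]
  have hden : ((z : ℂ).re - t) ^ 2 + z.im ^ 2 ≠ 0 := by
    have := z.im_pos; positivity
  exact analyticAt_const.div (((analyticAt_const.sub analyticAt_id).pow 2).add analyticAt_const) hden

/-- **`κ_w(t) = R_t(z₀)^w ∈ V_w^ω`.** [cite: BruggemanLewisZagier2015, (2.2) p. 12 and (2.25) p. 16] -/
theorem isAnalyticVector_hypPoissonKernelCpow (w : ℂ) (z₀ : ℍ) :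
    IsAnalyticVector w (fun x : ℝ => hypPoissonKernelCpow w x z₀) := by
  refine ⟨fun t _ => ?_, ?_⟩
  · unfold hypPoissonKernelCpow
    exact analyticAt_ofReal_cpow_const (analyticAt_hypPoissonKernel z₀ t)
      (hypPoissonKernel_pos t z₀.im_pos) w
  · set q : ℝ → ℝ := fun t => z₀.im / ((1 + t * (z₀ : ℂ).re) ^ 2 + (t * z₀.im) ^ 2) with hq
    have hden : ∀ t : ℝ, 0 < (1 + t * (z₀ : ℂ).re) ^ 2 + (t * z₀.im) ^ 2 := by
      intro t
      rcases eq_or_ne t 0 with rfl | ht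
      · norm_num
      · have : 0 < (t * z₀.im) ^ 2 := by
          have := z₀.im_pos; positivity
        nlinarith [sq_nonneg (1 + t * (z₀ : ℂ).re)]
    have hq0 : ∀ t, 0 < q t := fun t => div_pos z₀.im_pos (hden t)
    have hqa : AnalyticAt ℝ q 0 := by
      apply analyticAt_const.div
      · exact ((analyticAt_const.add (analyticAt_id.mul analyticAt_const)).pow 2).add
          ((analyticAt_id.mul analyticAt_const).pow 2)
      · exact (hden 0).ne'
    refine ⟨fun t => ((q t : ℝ) : ℂ) ^ w, analyticAt_ofReal_cpow_const hqa (hq0 0) w, fun t ht => ?_⟩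
    unfold hypPoissonKernelCpow
    have hrel : hypPoissonKernel (-1 / t) z₀ = t ^ 2 * q t := by
      rw [hypPoissonKernel_eq_div]
      simp only [hq]
      have him : (z₀ : ℂ).im = z₀.im := rfl
      rw [him]
      have hd := (hden t).ne'
      have ht2 : t ^ 2 ≠ 0 := pow_ne_zero 2 ht
      field_simp
      ring
    beta_reduce
    rw [hrel, abs_cpow_neg_mul_sq_mul_cpow ht (hq0 t).le w w, sub_self, Complex.cpow_zero, one_mul]

/-- **`φ̃ = -conj ∘ φ - c κ_{s̄} ∈ V_{s̄}^ω`.** [cite: BruggemanLewisZagier2015, (2.2) p. 12] -/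
theorem isAnalyticVector_conjSystem {s : ℂ} {φ : ℝ → ℂ} (h : IsAnalyticVector s φ) (c : ℂ) (z₀ : ℍ) :
    IsAnalyticVector (conj s) (fun x => -conj (φ x) - c * hypPoissonKernelCpow (conj s) x z₀) := by
  have h1 := h.conj_comp.neg
  have h2 := ((isAnalyticVector_hypPoissonKernelCpow (conj s) z₀).const_mul c).neg
  have := h1.add h2
  refine (show (fun x => -conj (φ x) - c * hypPoissonKernelCpow (conj s) x z₀) =
    fun x => -conj (φ x) + -(c * hypPoissonKernelCpow (conj s) x z₀) from ?_) ▸ this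
  funext x; ring

end ConjAnalyticVectors

/-! ## 30. Proposition 5.1: injectivity of `r`

Assembly of the proof of `BruggemanLewisZagier2015_prop_5_1`: under the coboundary hypothesis
at the base point `z₀`, the collar extension `Φ` of `φ` coincides with the canonical integral
`h` on the upper collar (§27), and the collar extension `Φ̃` of the conjugate system coincides
with the canonical integral of `(ū, s̄)` there; by the real identity theorem
`Φ̃(η) = -conj Φ(η̄) - conj u(z₀)` near `ℝ`, so the function equal to `h` on `ℍ`, to `Φ` on `ℝ`
and to `-u(z₀) - conj h̃(η̄)` on `ℍ⁻` is entire and bounded, hence constant (Liouville); its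
values at `z₀` and `z̄₀` are `0` and `-u(z₀)`. Finally the hypothesis is transported from
`z₀` to any `z` (the cocycles differ by the coboundary of the analytic vector
`t ↦ ∫_z^{z₀} [u, R_t^s]`). -/

section Injectivity

variable {Γ : Subgroup (GL (Fin 2) ℝ)} {s : ℂ} {u : ℍ → ℂ}

attribute [local irreducible] ratioKernel poissonKernelC in
/-- **Vanishing at the base point.** If `Γ` (determinant one, discrete, infinite) and
`u ∈ E_s^Γ` (`0 < Re s < 1`) are such that the period cocycle `r^{z₀}[u]` is the coboundary of an
analytic vector, then `u(z₀) = 0`. [cite: BruggemanLewisZagier2015, Proposition 5.1 pp. 30–31] -/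
theorem eq_zero_at_basepoint (hu : IsInvariantEigenfunction Γ s u) (hs : s.re < 1) (hs' : 0 < s.re)
    [hΓ : Γ.HasDetOne] (hdisc : DiscreteTopology Γ) (hinf : (Γ : Set (GL (Fin 2) ℝ)).Infinite)
    (z₀ : ℍ) {φ : ℝ → ℂ} (hφ : IsAnalyticVector s φ)
    (hcb : ∀ γ ∈ Γ, ∀ᶠ t : ℝ in cofinite, lewisZagierCocycle s z₀ u γ t = lineSlash s γ φ t - φ t) :
    u z₀ = 0 := by
  have hs0 : s ≠ 0 := fun h => by rw [h] at hs'; simp at hs'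
  have hs1 : s ≠ 1 := fun h => by rw [h] at hs; simp at hs
  have hz₀ : 0 < (z₀ : ℂ).im := z₀.coe_im_pos
  -- the upper system
  obtain ⟨T, δ, Φ, hT, hδ, hδT, -, hΦN, hΦr, B, hB⟩ := exists_collar_extension hs'.le hφ hz₀
  have hvan := collar_vanishing hu hs hs' hs1 hdisc hinf z₀ hT hδ hΦN hΦr hcb
  -- the conjugate system
  set ub : ℍ → ℂ := fun z => conj (u z) with hub
  have hub' : IsInvariantEigenfunction Γ (conj s) ub := hu.conj
  set φb : ℝ → ℂ := fun x => -conj (φ x) - conj (u z₀) * hypPoissonKernelCpow (conj s) x z₀ with hφb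
  have hφb' : IsAnalyticVector (conj s) φb := isAnalyticVector_conjSystem hφ _ z₀
  have hcbb := conj_coboundary_hypothesis hu z₀ hcb
  have hsb : (conj s).re < 1 := by simpa using hs
  have hsb' : 0 < (conj s).re := by simpa using hs'
  have hsb1 : conj s ≠ 1 := fun h => hs1 (by simpa using congrArg conj h)
  obtain ⟨T', δ', Φ', hT', hδ', hδT', -, hΦ'N, hΦ'r, B', hB'⟩ :=
    exists_collar_extension (s := conj s) hsb'.le hφb' hz₀
  have hvan' := collar_vanishing hub' hsb hsb' hsb1 hdisc hinf z₀ hT' hδ' hΦ'N hΦ'r hcbb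
  -- the two canonical integrals
  set HC : ℂ → ℂ := fun ξ => greenSegmentIntegral (u ∘ ofComplex) (ratioKernel s z₀ ξ) z₀ ξ with hHC
  set HC' : ℂ → ℂ := fun ξ => greenSegmentIntegral (ub ∘ ofComplex) (ratioKernel (conj s) z₀ ξ) z₀ ξ with hHC'
  have hHCd : DifferentiableOn ℂ HC {η : ℂ | 0 < η.im} := differentiableOn_canonicalIntegral hu hs hs0 hs1 hz₀
  have hRd : DifferentiableOn ℂ (fun η : ℂ => conj (HC' (conj η))) {η : ℂ | η.im < 0} := by
    have := differentiableOn_conj_canonicalIntegral hu hs hs0 hs1 hz₀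
    simpa only [hHC', hub] using this
  -- the open domains
  set N : Set ℂ := {η : ℂ | T < |η.re|} ∪ {η : ℂ | T < |η.im|} ∪ {η : ℂ | |η.im| < δ} with hN
  set N' : Set ℂ := {η : ℂ | T' < |η.re|} ∪ {η : ℂ | T' < |η.im|} ∪ {η : ℂ | |η.im| < δ'} with hN'
  have hNo : IsOpen N := by
    refine ((isOpen_lt continuous_const (continuous_abs.comp Complex.continuous_re)).union
      (isOpen_lt continuous_const (continuous_abs.comp Complex.continuous_im))).union
      (isOpen_lt (continuous_abs.comp Complex.continuous_im) continuous_const)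
  have hN'o : IsOpen N' := by
    refine ((isOpen_lt continuous_const (continuous_abs.comp Complex.continuous_re)).union
      (isOpen_lt continuous_const (continuous_abs.comp Complex.continuous_im))).union
      (isOpen_lt (continuous_abs.comp Complex.continuous_im) continuous_const)
  -- real values of the two extensions
  have hP : ∀ t : ℝ, poissonKernelC (t : ℂ) (z₀ : ℂ) = ((hypPoissonKernel t z₀ : ℝ) : ℂ) :=
    fun t => poissonKernelC_ofReal t z₀
  have hrealid : ∀ t : ℝ, Φ' t = -conj (Φ t) - conj (u z₀) := by
    intro t
    rw [hΦ'r, hΦr]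
    simp only [hφb, hP t, hypPoissonKernelCpow]
    have hpos : 0 ≤ hypPoissonKernel t z₀ := (hypPoissonKernel_pos t hz₀).le
    have hne : ((hypPoissonKernel t z₀ : ℝ) : ℂ) ^ conj s ≠ 0 := by
      rw [Ne, Complex.cpow_eq_zero_iff, not_and_or]; left
      exact_mod_cast (hypPoissonKernel_pos t hz₀).ne'
    rw [map_mul, conj_ofReal_cpow_of_nonneg hpos, map_neg]
    have e : ((hypPoissonKernel t z₀ : ℝ) : ℂ) ^ conj s * ((hypPoissonKernel t z₀ : ℝ) : ℂ) ^ (-conj s) = 1 := by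
      rw [Complex.cpow_neg, mul_inv_cancel₀ hne]
    linear_combination (-conj (u z₀)) * e
  -- the reflection identity on discs around real points
  set r : ℝ := min δ δ' with hr
  have hr0 : 0 < r := lt_min hδ hδ'
  have hballN : ∀ (t : ℝ) (η : ℂ), η ∈ Metric.ball (t : ℂ) r → |η.im| < δ ∧ |η.im| < δ' := by
    intro t η hη
    rw [Metric.mem_ball, dist_eq_norm] at hη
    have h1 : |η.im| < r := by
      have := Complex.abs_im_le_norm (η - t)
      simp at this
      linarith
    exact ⟨lt_of_lt_of_le h1 (min_le_left _ _), lt_of_lt_of_le h1 (min_le_right _ _)⟩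
  have hrefl : ∀ (t : ℝ), ∀ η ∈ Metric.ball (t : ℂ) r, Φ' η = -conj (Φ (conj η)) - conj (u z₀) := by
    intro t
    have hd1 : DifferentiableOn ℂ Φ' (Metric.ball (t : ℂ) r) :=
      hΦ'N.mono fun η hη => Or.inr (hballN t η hη).2
    have hd2 : DifferentiableOn ℂ (fun η : ℂ => -conj (Φ (conj η)) - conj (u z₀)) (Metric.ball (t : ℂ) r) := by
      intro η hη
      have hcN : conj η ∈ N := Or.inr (by simpa using (hballN t η hη).1)
      have hΦd : DifferentiableAt ℂ Φ (conj η) := hΦN.differentiableAt (hNo.mem_nhds hcN)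
      have := hΦd.conj_conj
      rw [Complex.conj_conj] at this
      exact (this.neg.sub_const _).differentiableWithinAt
    have hev : ∀ᶠ x : ℝ in 𝓝[≠] t, Φ' x = (fun η : ℂ => -conj (Φ (conj η)) - conj (u z₀)) x :=
      Eventually.of_forall fun x => by simp only [Complex.conj_ofReal]; exact hrealid x
    exact eqOn_of_eqOn_real Metric.isOpen_ball (convex_ball _ _).isPreconnected
      (Metric.mem_ball_self hr0) hd1 hd2 hev
  -- the global function
  set Fg : ℂ → ℂ := fun η => if 0 < η.im then HC η else if η.im = 0 then Φ η
    else -u z₀ - conj (HC' (conj η)) with hFg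
  -- near a real point `Fg = Φ`
  have hFgΦ : ∀ (t : ℝ), ∀ η ∈ Metric.ball (t : ℂ) r, Fg η = Φ η := by
    intro t η hη
    obtain ⟨h1, h2⟩ := hballN t η hη
    rcases lt_trichotomy η.im 0 with hlt | heq | hgt
    · simp only [hFg, if_neg (not_lt.mpr hlt.le), if_neg hlt.ne]
      have hc : 0 < (conj η).im := by simp; linarith
      have hcond : T' < |(conj η).re| ∨ T' < |(conj η).im| ∨ |(conj η).im| < δ' :=
        Or.inr (Or.inr (by simpa using h2))
      have hv := hvan' (conj η) hc hcond
      have hmem : conj η ∈ Metric.ball (t : ℂ) r := by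
        rw [Metric.mem_ball, Complex.dist_eq, ← Complex.conj_ofReal, ← map_sub, Complex.norm_conj]
        rwa [Metric.mem_ball, Complex.dist_eq] at hη
      have hre := hrefl t (conj η) hmem
      rw [Complex.conj_conj] at hre
      simp only [hHC'] at hv ⊢
      rw [← hv, hre]
      simp only [map_sub, map_neg, Complex.conj_conj]
      ring
    · simp only [hFg, if_neg (show ¬(0 < η.im) from by rw [heq]; exact lt_irrefl 0), if_pos heq]
    · simp only [hFg, if_pos hgt]
      exact (hvan η hgt (Or.inr (Or.inr h1))).symm
  -- `Fg` is entire
  have hFgd : Differentiable ℂ Fg := by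
    intro η
    rcases lt_trichotomy η.im 0 with hlt | heq | hgt
    · have hev : Fg =ᶠ[𝓝 η] fun η => -u z₀ - conj (HC' (conj η)) := by
        filter_upwards [(isOpen_lt Complex.continuous_im continuous_const).mem_nhds hlt] with η' hη'
        have hη'' : η'.im < 0 := hη'
        simp only [hFg, if_neg (not_lt.mpr hη''.le), if_neg hη''.ne]
      refine DifferentiableAt.congr_of_eventuallyEq ?_ hev
      exact ((hRd.differentiableAt ((isOpen_lt Complex.continuous_im continuous_const).mem_nhds hlt)).const_sub _)
    · have hη : η = ((η.re : ℝ) : ℂ) := by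
        apply Complex.ext <;> simp [heq]
      have hball : Metric.ball ((η.re : ℝ) : ℂ) r ∈ 𝓝 η := by
        apply Metric.isOpen_ball.mem_nhds
        rw [hη]; simp [hr0]
      have hev : Fg =ᶠ[𝓝 η] Φ := by
        filter_upwards [hball] with η' hη'
        exact hFgΦ η.re η' hη'
      refine DifferentiableAt.congr_of_eventuallyEq ?_ hev
      have hηN : η ∈ N := Or.inr (by simp [heq, hδ])
      exact hΦN.differentiableAt (hNo.mem_nhds hηN)
    · have hev : Fg =ᶠ[𝓝 η] HC := by
        filter_upwards [isOpen_upperHalfPlaneSet.mem_nhds hgt] with η' hη'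
        have : 0 < η'.im := hη'
        simp only [hFg, if_pos this]
      refine DifferentiableAt.congr_of_eventuallyEq ?_ hev
      exact hHCd.differentiableAt (isOpen_upperHalfPlaneSet.mem_nhds hgt)
  -- `Fg` is bounded
  have hFgb : ∃ C : ℝ, ∀ η : ℂ, ‖Fg η‖ ≤ C := by
    set Ts : ℝ := max T T' + 1 with hTs
    -- bound far out
    have hfarb : ∀ η : ℂ, (Ts < |η.re| ∨ Ts < |η.im|) → ‖Fg η‖ ≤ max B (‖u z₀‖ + B') := by
      intro η hη
      have hT1 : T < Ts := by simp only [hTs]; linarith [le_max_left T T']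
      have hT2 : T' < Ts := by simp only [hTs]; linarith [le_max_right T T']
      rcases lt_trichotomy η.im 0 with hlt | heq | hgt
      · simp only [hFg, if_neg (not_lt.mpr hlt.le), if_neg hlt.ne]
        have hc : 0 < (conj η).im := by simp; linarith
        have hcond2 : T' < |(conj η).re| ∨ T' < |(conj η).im| := by
          rcases hη with h | h
          · left; rw [Complex.conj_re]; linarith
          · right; rw [Complex.conj_im, abs_neg]; linarith
        have hcond : T' < |(conj η).re| ∨ T' < |(conj η).im| ∨ |(conj η).im| < δ' := by
          rcases hcond2 with h | h
          · exact Or.inl h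
          · exact Or.inr (Or.inl h)
        have hv := hvan' (conj η) hc hcond
        show ‖-u z₀ - conj (greenSegmentIntegral (ub ∘ ofComplex) (ratioKernel (conj s) z₀ (conj η))
          z₀ (conj η))‖ ≤ _
        rw [← hv]
        calc ‖-u z₀ - conj (Φ' (conj η))‖ ≤ ‖u z₀‖ + ‖conj (Φ' (conj η))‖ := by
              rw [sub_eq_add_neg]; exact (norm_add_le _ _).trans (by rw [norm_neg, norm_neg])
          _ ≤ ‖u z₀‖ + B' := by rw [Complex.norm_conj]; linarith [hB' (conj η) hcond2]
          _ ≤ max B (‖u z₀‖ + B') := le_max_right _ _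
      · simp only [hFg, if_neg (show ¬(0 < η.im) from by rw [heq]; exact lt_irrefl 0), if_pos heq]
        have hcond : T < |η.re| ∨ T < |η.im| := by
          rcases hη with h | h
          · left; linarith
          · right; linarith
        exact (hB η hcond).trans (le_max_left _ _)
      · simp only [hFg, if_pos hgt]
        have hcond2 : T < |η.re| ∨ T < |η.im| := by
          rcases hη with h | h
          · left; linarith
          · right; linarith
        have hcond : T < |η.re| ∨ T < |η.im| ∨ |η.im| < δ := by
          rcases hcond2 with h | h
          · exact Or.inl h
          · exact Or.inr (Or.inl h)
        show ‖greenSegmentIntegral (u ∘ ofComplex) (ratioKernel s z₀ η) z₀ η‖ ≤ _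
        rw [← hvan η hgt hcond]
        exact (hB η hcond2).trans (le_max_left _ _)
    -- bound on the box
    set K : Set ℂ := {η : ℂ | |η.re| ≤ Ts ∧ |η.im| ≤ Ts} with hK
    have hKc : IsCompact K := by
      apply Metric.isCompact_of_isClosed_isBounded
      · simp only [hK, Set.setOf_and]
        exact (isClosed_le (continuous_abs.comp Complex.continuous_re) continuous_const).inter
          (isClosed_le (continuous_abs.comp Complex.continuous_im) continuous_const)
      · rw [Metric.isBounded_iff_subset_closedBall 0]
        refine ⟨Ts + Ts, fun η hη => ?_⟩
        rw [Metric.mem_closedBall, dist_zero_right]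
        exact (Complex.norm_le_abs_re_add_abs_im η).trans (add_le_add hη.1 hη.2)
    obtain ⟨C₀, hC₀⟩ := hKc.exists_bound_of_continuousOn hFgd.continuous.continuousOn
    refine ⟨max C₀ (max B (‖u z₀‖ + B')), fun η => ?_⟩
    by_cases hfar : Ts < |η.re| ∨ Ts < |η.im|
    · exact (hfarb η hfar).trans (le_max_right _ _)
    · push Not at hfar
      exact (hC₀ η ⟨hfar.1, hfar.2⟩).trans (le_max_left _ _)
  -- Liouville
  obtain ⟨C, hC⟩ := hFgb
  have hbdd : Bornology.IsBounded (range Fg) := by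
    rw [isBounded_iff_forall_norm_le]
    exact ⟨C, by rintro _ ⟨η, rfl⟩; exact hC η⟩
  have hconst := hFgd.apply_eq_apply_of_bounded hbdd (z₀ : ℂ) (conj (z₀ : ℂ))
  have h1 : Fg z₀ = 0 := by
    simp only [hFg, if_pos hz₀, hHC, greenSegmentIntegral_self]
  have h2 : Fg (conj (z₀ : ℂ)) = -u z₀ := by
    have hneg : (conj (z₀ : ℂ)).im < 0 := by simp; exact z₀.im_pos
    simp only [hFg, if_neg (not_lt.mpr hneg.le), if_neg hneg.ne, Complex.conj_conj, hHC',
      greenSegmentIntegral_self, map_zero, sub_zero]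
  rw [h1, h2] at hconst
  have := hconst.symm
  rwa [neg_eq_zero] at this

/-- **BLZ Proposition 5.1 (injectivity of `r`)** — discharge of the named fact
`BruggemanLewisZagier2015_prop_5_1`: for an infinite discrete `Γ ≤ GL₂(ℝ)` of determinant one,
`0 < Re s < 1` and `u ∈ E_s^Γ`, if the period cocycle `γ ↦ r_γ` of `u` (base point `z₀`) is the
coboundary of an analytic vector `φ ∈ V_s^ω` in the line model (off finite sets), then `u = 0`.
The printed proof ("`r` is the composite of the injection `E_s^Γ → (V_s^{-ω})^Γ` with the
connecting map, whose kernel `H_s^Γ` vanishes by an argument on a collar", p. 31) is realized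
through the canonical hybrid model of the companion paper (§8–§28).
[cite: BruggemanLewisZagier2015, Proposition 5.1 pp. 30–31] -/
theorem BruggemanLewisZagier2015_prop_5_1_holds : BruggemanLewisZagier2015_prop_5_1 := by
  intro Γ hΓ hdisc hinf s hs' hs u hu z₀ hyp z
  obtain ⟨φ, hφ, hcb⟩ := hyp
  haveI := hΓ
  have hs0 : s ≠ 0 := fun h => by rw [h] at hs'; simp at hs'
  have hs1 : s ≠ 1 := fun h => by rw [h] at hs; simp at hs
  -- transport the coboundary hypothesis from `z₀` to `z`
  set P : ℝ → ℂ := greenPeriod s u z z₀ with hP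
  have hPav : IsAnalyticVector s P := isAnalyticVector_greenPeriod s hu.isC2 z z₀
  have hcb' : ∀ γ ∈ Γ, ∀ᶠ t : ℝ in cofinite,
      lewisZagierCocycle s z u γ t = lineSlash s γ (fun x => φ x + P x) t - (φ t + P t) := by
    intro γ hγ
    have hdet : γ.det.val = 1 := by
      have := hΓ.det_eq hγ
      rw [this]; rfl
    filter_upwards [hcb γ hγ, eventually_cofinite_denom_ne_zero hdet] with t ht hp
    have h1 := greenPeriod_add hu hs0 hs1 t (γ⁻¹ • z) (γ⁻¹ • z₀) z
    have h2 := greenPeriod_add hu hs0 hs1 t (γ⁻¹ • z₀) z₀ z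
    have h3 := lineSlash_greenPeriod hu hs0 hs1 hγ z z₀ hp
    have h4 := greenPeriod_swap hu hs0 hs1 t z z₀
    have h5 : lewisZagierCocycle s z₀ u γ t = greenPeriod s u (γ⁻¹ • z₀) z₀ t := rfl
    have h6 : lewisZagierCocycle s z u γ t = greenPeriod s u (γ⁻¹ • z) z t := rfl
    rw [h6, lineSlash_fun_add, h3, ← h1, ← h2, h4, ← h5, ht]
    simp only [hP]
    ring
  exact eq_zero_at_basepoint hu hs hs' hdisc hinf z (hφ.add hPav) hcb'

end Injectivity

end Literature.NumberTheory.Automorphic
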